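import Literature.AlgebraicGeometry.HodgeTheory.HeckePrymF21WeilTwelvefoldOfRiemannExistence
import Literature.AlgebraicGeometry.Motives.JacobianExistenceSplit
import HarnessLib

/-!
# `exists_heckePrymDatum_F21`: a more symmetric witness — the Weil type `(6, 6)` WITHOUT holomorphic fixed-point theory

Seventh proof file of the named fact
`Literature.AlgebraicGeometry.HodgeTheory.exists_heckePrymDatum_F21` (`HeckePrymF21WeilTwelvefold`),
after `…Proofs`, `…WeilType`, `…Dimension`, `…WeilTypeOfCurve`, `WeilClassesRationalPlane` and
`…OfRiemannExistence`. The last of these reduced the fact to FOUR classical inputs: Riemann's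
existence theorem for free actions with prescribed group (`hRE`, [LangeRodriguez2022, Thm. 3.1.1]),
the holomorphic Lefschetz fixed-point formula (`hL`, [AtiyahBott1968, Thm. 4.12]) — needed only to
know that the Hecke–Prym `(P', φ')` of the étale `F₂₁`-curve of genus `43` has BALANCED Weil type
`(6, 6)`, i.e. that the holomorphic count `c₊ = dim (H¹(C)^τ ∩ ker(η_C - i√7) ∩ H^{1,0}(C))` is `6`
and not merely `c₊ + c₋ = 12` (which is topological) — and the tree's two Jacobian facts.

This file REMOVES the holomorphic input altogether, by a different choice of witness. The fact is
an existential statement over the curve; instead of an arbitrary étale `F₂₁`-cover of a genus-3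
curve we take an étale cover `C → C/F₄₂` of a genus-2 curve with group the full Frobenius group
`F₄₂ = ℤ/7 ⋊ (ℤ/7)ˣ = ⟨s, u | s⁷ = u⁶ = 1, u s u⁻¹ = s³⟩` (generating vector `(s, u; 1, 1)` of type
`(2; —)`, [LangeRodriguez2022, §3.1.2, Thm. 3.1.1]; again `g(C) = 1 + 42 = 43`), and put `σ = ρ(s)`,
`τ = ρ(u²)` (`u² s u⁻² = s⁹ = s²`: the `F₂₁`-relations). The extra automorphism `υ = ρ(u)` normalises
`F₂₁` and induces `σ ↦ σ³`, which EXCHANGES the quadratic residues `{1, 2, 4}` and the non-residues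
`{3, 5, 6}` mod `7`; hence `η_C ∘ υ^* = -υ^* ∘ η_C` for the Gauss-sum element
`η_C = σ^* + (σ^*)² + (σ^*)⁴ - (σ^*)³ - (σ^*)⁵ - (σ^*)⁶`, and `υ^*` (which preserves `H^{1,0}` and
commutes with `τ^* = (υ^*)²`) is a linear bijection
`H¹(C)^τ ∩ ker(η_C - i√7) ∩ H^{1,0} ≅ H¹(C)^τ ∩ ker(η_C + i√7) ∩ H^{1,0}`, i.e. **`c₊ = c₋`**. The sum
`c₊ + c₋ = 12` is TOPOLOGICAL: on `W = H¹(C(ℂ); ℂ)` (`dim W = 86`) the two projectors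
`Π_{±} = -(1/42)(η² ± i√7 η)(1 + τ^* + (τ^*)²)` onto `X_± = W^τ ∩ ker(η_C ∓ i√7)` have
`tr Π₊ + tr Π₋ = -(1/21) tr(η²(1 + τ^* + τ^{*2})) = (dim W - dim W^σ)/3 = (86 - 14)/3 = 24`
(`η² = Φ₇(σ^*) - 7`, `tr((σ^*)ᵏ τ^{*j}) = tr(τ^{*j})`, Smith theory `dim W^σ = 14` — all in the tree),
while `X_± = (X_± ∩ H^{1,0}) ⊕ (X_± ∩ H^{0,1})` and complex conjugation give
`dim X₊ = dim X₋ = c₊ + c₋`. So `c₊ = 6`, which is exactly hypothesis `h6` of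
`exists_heckePrymDatum_F21_of_isIso_of_nonempty_jacobian_of_curve` (`…WeilTypeOfCurve`).

Result: **`exists_heckePrymDatum_F21_of_riemannExistence (hRE) (hI) (hJ)`** — the named fact from
Riemann's existence theorem (verbatim the hypothesis `hRE` of `…OfRiemannExistence`) and the two
EXISTING Jacobian facts `Motives.isIso_bettiCohomology_map_abelJacobi`,
`Motives.nonempty_jacobian_of_isSmoothProjective`, with NO holomorphic Lefschetz / Chevalley–Weil input.

* §1 (linear algebra of `⟨S, T, U | S⁷ = 1, SU = US³, T = U²⟩`): `weilElement_mul_eq_neg` (`ηU = -Uη`),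
  `map_mem_ker_inf_eigenspace_weilElement_neg`, `finrank_ker_inf_eigenspace_inf_eq_of_symmetry`
  (`dim (X_ν ∩ P) = dim (X_{-ν} ∩ P)` for a `U`-stable `P`), `trace_weilElement_sq_mul_sum_range_pow`
  (`tr(η²(1 + T + T²)) = 7 dim V^S - 7 dim V`), `three_mul_finrank_ker_inf_eigenspace_add`
  (`3 (dim X_μ + dim X_{-μ}) + dim V^S = dim V` for `μ² = -7`);
* §2 (the curve): `components_of_forall_map_mem` (Hodge components of an eigenvector of an operator
  preserving `H^{1,0}` and `H^{0,1}`), `finrank_ker_inf_eigenspace_eq_add` (`dim X_ν = c_ν + d_ν`),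
  `finrank_inf_hodgeOneZero_eq_six_of_symmetry` (the count `6` from `s, t = u², u` and `b₁ = 86`);
* §3 `exists_group_F42`, `exists_curve_F42_of_riemannExistence`;
* §4 `exists_curveDatum_F42_of_riemannExistence` (the curve-level datum from `hRE` alone),
  `exists_heckePrymDatum_F21_of_riemannExistence` (`hRE`, `hI`, `hJ`) and
  `exists_heckePrymDatum_F21_of_riemannExistence_of_leafFacts` (`hRE` and the LEAF Jacobian facts
  `Motives.two_mul_dim_eq_finrank_bettiCohomology`, `Motives.nonempty_jacobian_of_algPoints` — over
  `ℂ` a curve has a point, so no Galois descent of the Jacobian is needed).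

Everything is proved; no definition, no named fact (D-0026). The residue of the named fact is now
exactly: Riemann's existence theorem `hRE` [LangeRodriguez2022, Thm. 3.1.1; SGA1 XII 5.1] (absent
from the tree) and the two leaf Jacobian facts `two_mul_dim_eq_finrank_bettiCohomology`,
`nonempty_jacobian_of_algPoints` (present, unproved; by `Motives/JacobianDimensionBounds` the first
is the inequality `b₁(C(ℂ)) ≤ 2 dim J(C)`, Riemann's period count).

## References

* [LangeRodriguez2022] H. Lange, R. E. Rodríguez, *Decomposition of Jacobians by Prym Varieties*,
  LNM 2310 (2022): §3.1.2 and Thm. 3.1.1 (PDF pp. 51–52), §3.2 (3.5)–(3.6) (PDF p. 56), §3.5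
  Cor. 3.5.9–3.5.10 (PDF pp. 70–71).
* [SGA1] A. Grothendieck, SGA 1, Exp. XII Thm. 5.1 (Riemann's existence theorem).
* [SerreLinearRepresentations1977] J.-P. Serre, *Linear Representations of Finite Groups*, §2.3, §2.6.
* [VoisinHodgeI2002] C. Voisin, *Hodge Theory and Complex Algebraic Geometry I*, §6.1.3 Cor. 6.12,
  Cor. 6.14, §7.3.2.
* [Schoen1988HodgeWeil] C. Schoen, *Hodge classes on self-products of a variety with an automorphism*,
  Compositio Math. 65 (1988), §3.
* [Milne1986JacobianVarieties] J. S. Milne, *Jacobian Varieties* (1986), Thm. 1.1, Prop. 2.1.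
-/

noncomputable section

open CategoryTheory
open Literature.AlgebraicTopology.SingularHomology

namespace Literature.AlgebraicGeometry.HodgeTheory

open Literature.AlgebraicGeometry Literature.AlgebraicGeometry.Motives

/-! ### §1 Linear algebra: the symmetry `U` (`SU = US³`, `T = U²`) and the topological count -/

section LinearAlgebra

variable {V : Type*} [AddCommGroup V] [Module ℂ V] {S T U : Module.End ℂ V}

/-- `Sᵏ U = U S³ᵏ` from `S U = U S³`. [folklore] -/
theorem pow_mul_eq_mul_pow_three_mul (hSU : S * U = U * S ^ 3) (k : ℕ) :
    S ^ k * U = U * S ^ (3 * k) := by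
  induction k with
  | zero => simp
  | succ k ih =>
    rw [pow_succ', mul_assoc, ih, ← mul_assoc, hSU, mul_assoc, ← pow_add]
    congr 2
    ring

/-- **`η U = -U η`** for the Gauss-sum element `η = S + S² + S⁴ - S³ - S⁵ - S⁶` and a `U` with
`S U = U S³`, `S⁷ = 1`: conjugation by `U` is `Sᵏ ↦ S³ᵏ`, and `k ↦ 3k` exchanges the quadratic
residues `{1, 2, 4}` and the non-residues `{3, 5, 6}` mod `7` (`3` is a non-residue).
[cite: Schoen1988HodgeWeil, §3 (p. 24)] -/
theorem weilElement_mul_eq_neg (hS : S ^ 7 = 1) (hSU : S * U = U * S ^ 3) :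
    (S + S ^ 2 + S ^ 4 - S ^ 3 - S ^ 5 - S ^ 6) * U =
      -(U * (S + S ^ 2 + S ^ 4 - S ^ 3 - S ^ 5 - S ^ 6)) := by
  have h : ∀ k : ℕ, S ^ k * U = U * S ^ (3 * k % 7) := fun k => by
    rw [pow_mul_eq_mul_pow_three_mul hSU k, pow_eq_pow_mod_seven hS (3 * k)]
  have h1 : S * U = U * S ^ 3 := hSU
  simp only [add_mul, sub_mul, mul_add, mul_sub, h, h1]
  norm_num
  abel

/-- **`U` maps `X_ν = V^T ∩ ker(η - ν)` into `X_{-ν}`** (`T = U²` commutes with `U`, `ηU = -Uη`).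
[folklore] -/
theorem map_mem_ker_inf_eigenspace_weilElement_neg (hS : S ^ 7 = 1) (hSU : S * U = U * S ^ 3)
    (hTU : T = U ^ 2) {ν : ℂ} {x : V}
    (hx : x ∈ LinearMap.ker (T - 1) ⊓
      Module.End.eigenspace (S + S ^ 2 + S ^ 4 - S ^ 3 - S ^ 5 - S ^ 6) ν) :
    U x ∈ LinearMap.ker (T - 1) ⊓
      Module.End.eigenspace (S + S ^ 2 + S ^ 4 - S ^ 3 - S ^ 5 - S ^ 6) (-ν) := by
  rw [Submodule.mem_inf, LinearMap.mem_ker, LinearMap.sub_apply, Module.End.one_apply, sub_eq_zero,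
    Module.End.mem_eigenspace_iff] at hx ⊢
  obtain ⟨hxT, hxη⟩ := hx
  have hTU' : T * U = U * T := by rw [hTU, ← pow_succ, ← pow_succ']
  refine ⟨?_, ?_⟩
  · rw [← Module.End.mul_apply, hTU', Module.End.mul_apply, hxT]
  · rw [← Module.End.mul_apply, weilElement_mul_eq_neg hS hSU, LinearMap.neg_apply,
      Module.End.mul_apply, hxη, map_smul, neg_smul]

/-- **`dim (X_ν ∩ P) = dim (X_{-ν} ∩ P)`** for every `U`-stable subspace `P`, `X_ν = V^T ∩ ker(η - ν)`:
`U` is injective (`U⁶ = T³ = 1`) and maps `X_ν ∩ P` into `X_{-ν} ∩ P` and `X_{-ν} ∩ P` into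
`X_ν ∩ P`. [folklore] -/
theorem finrank_ker_inf_eigenspace_inf_eq_of_symmetry [FiniteDimensional ℂ V] (hS : S ^ 7 = 1)
    (hT : T ^ 3 = 1) (hSU : S * U = U * S ^ 3) (hTU : T = U ^ 2) (P : Submodule ℂ V)
    (hP : ∀ x ∈ P, U x ∈ P) (ν : ℂ) :
    Module.finrank ℂ ↥(LinearMap.ker (T - 1) ⊓
        Module.End.eigenspace (S + S ^ 2 + S ^ 4 - S ^ 3 - S ^ 5 - S ^ 6) ν ⊓ P) =
      Module.finrank ℂ ↥(LinearMap.ker (T - 1) ⊓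
        Module.End.eigenspace (S + S ^ 2 + S ^ 4 - S ^ 3 - S ^ 5 - S ^ 6) (-ν) ⊓ P) := by
  set η : Module.End ℂ V := S + S ^ 2 + S ^ 4 - S ^ 3 - S ^ 5 - S ^ 6 with hη
  have hU6 : U ^ 6 = 1 := by rw [show 6 = 2 * 3 from rfl, pow_mul, ← hTU, hT]
  have h65 : U ^ 5 * U = 1 := by rw [← pow_succ]; exact hU6
  have hinj : Function.Injective U := fun x y hxy => by
    have h : (U ^ 5 * U) x = (U ^ 5 * U) y := by rw [Module.End.mul_apply, Module.End.mul_apply, hxy]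
    rwa [h65, Module.End.one_apply, Module.End.one_apply] at h
  have hle : ∀ ν : ℂ, Module.finrank ℂ ↥(LinearMap.ker (T - 1) ⊓ Module.End.eigenspace η ν ⊓ P) ≤
      Module.finrank ℂ ↥(LinearMap.ker (T - 1) ⊓ Module.End.eigenspace η (-ν) ⊓ P) := by
    intro ν
    let f : ↥(LinearMap.ker (T - 1) ⊓ Module.End.eigenspace η ν ⊓ P) →ₗ[ℂ]
        ↥(LinearMap.ker (T - 1) ⊓ Module.End.eigenspace η (-ν) ⊓ P) :=
      LinearMap.codRestrict _ (U ∘ₗ (LinearMap.ker (T - 1) ⊓ Module.End.eigenspace η ν ⊓ P).subtype)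
        fun x => Submodule.mem_inf.2
          ⟨map_mem_ker_inf_eigenspace_weilElement_neg hS hSU hTU (Submodule.mem_inf.1 x.2).1,
            hP _ (Submodule.mem_inf.1 x.2).2⟩
    refine LinearMap.finrank_le_finrank_of_injective (f := f) fun x y hxy => ?_
    have h := congrArg Subtype.val hxy
    simp only [f, LinearMap.codRestrict_apply, LinearMap.comp_apply, Submodule.subtype_apply] at h
    exact Subtype.ext (hinj h)
  refine le_antisymm (hle ν) ?_
  have h := hle (-ν)
  rwa [neg_neg] at h

/-- **`tr(η² (1 + T + T²)) = 7 dim V^S - 7 dim V`** for `S⁷ = 1`, `ST = TS²`: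
`η² = Φ₇(S) - 7` (`weilElement_sq_eq`), `tr(Φ₇(S) Tʲ) = 7 tr(Tʲ)` for `j = 1, 2`
(`trace_pow_mul_eq`, `trace_pow_mul_sq_eq`) and `tr Φ₇(S) = 7 dim V^S`
(`card_mul_finrank_ker_eq_sum_trace_pow`) — the `T`-terms cancel.
[cite: SerreLinearRepresentations1977, §2.3 and §2.6] -/
theorem trace_weilElement_sq_mul_sum_range_pow [FiniteDimensional ℂ V] (hS : S ^ 7 = 1)
    (hST : S * T = T * S ^ 2) :
    LinearMap.trace ℂ V ((S + S ^ 2 + S ^ 4 - S ^ 3 - S ^ 5 - S ^ 6) ^ 2 *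
        ∑ j ∈ Finset.range 3, T ^ j) =
      7 * (Module.finrank ℂ (LinearMap.ker (S - 1)) : ℂ) - 7 * (Module.finrank ℂ V : ℂ) := by
  have h7 := card_mul_finrank_ker_eq_sum_trace_pow S hS (by norm_num : ((7 : ℕ) : ℂ) ≠ 0)
  push_cast at h7
  set Φ : Module.End ℂ V := ∑ i ∈ Finset.range 7, S ^ i with hΦ
  have hΦ0 : LinearMap.trace ℂ V Φ = 7 * (Module.finrank ℂ (LinearMap.ker (S - 1)) : ℂ) := by
    rw [hΦ, map_sum, ← h7]
  have hΦ1 : LinearMap.trace ℂ V (Φ * T) = 7 * LinearMap.trace ℂ V T := by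
    rw [hΦ, Finset.sum_mul, map_sum]
    simp only [trace_pow_mul_eq hS hST, Finset.sum_const, Finset.card_range, nsmul_eq_mul,
      Nat.cast_ofNat]
  have hΦ2 : LinearMap.trace ℂ V (Φ * T ^ 2) = 7 * LinearMap.trace ℂ V (T ^ 2) := by
    rw [hΦ, Finset.sum_mul, map_sum]
    simp only [trace_pow_mul_sq_eq hS hST, Finset.sum_const, Finset.card_range, nsmul_eq_mul,
      Nat.cast_ofNat]
  rw [weilElement_sq_eq hS, ← hΦ, sub_mul, map_sub, smul_mul_assoc, one_mul, map_smul, smul_eq_mul,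
    Finset.mul_sum, map_sum, map_sum]
  simp only [Finset.sum_range_succ, Finset.sum_range_zero, zero_add, pow_zero, mul_one, pow_one,
    LinearMap.trace_one]
  rw [hΦ0, hΦ1, hΦ2]
  ring

/-- **The topological `F₂₁`-count `3 (dim X_μ + dim X_{-μ}) + dim V^S = dim V`** for operators
`S⁷ = 1`, `T³ = 1`, `ST = TS²` on a finite-dimensional complex vector space, `μ² = -7`,
`X_ν = V^T ∩ ker(η - ν)`: the traces of the two projectors `Π_ν = -(1/42)(η² + νη)(1 + T + T²)`
(`isProj_ker_inf_eigenspace_weilElement`) add up to `-(1/21) tr(η²(1 + T + T²))`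
(`trace_weilElement_sq_mul_sum_range_pow`) — the term `ν tr(η(1 + T + T²))` cancels, so no
individual character value of `S` is needed. For `H¹` of the étale `F₂₁`-curve of genus `43`
(`dim V = 86`, `dim V^S = 14`): `dim X_μ + dim X_{-μ} = 24`. [cite: SerreLinearRepresentations1977, §2.3 and §2.6]
[cite: LangeRodriguez2022, §3.2 (3.6) (PDF p. 56) and §3.5 Cor. 3.5.9–3.5.10 (PDF pp. 70–71)] -/
theorem three_mul_finrank_ker_inf_eigenspace_add [FiniteDimensional ℂ V] (hS : S ^ 7 = 1)
    (hT : T ^ 3 = 1) (hST : S * T = T * S ^ 2) {μ : ℂ} (hμ : μ ^ 2 = -7) :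
    3 * (Module.finrank ℂ ↥(LinearMap.ker (T - 1) ⊓
          Module.End.eigenspace (S + S ^ 2 + S ^ 4 - S ^ 3 - S ^ 5 - S ^ 6) μ) +
        Module.finrank ℂ ↥(LinearMap.ker (T - 1) ⊓
          Module.End.eigenspace (S + S ^ 2 + S ^ 4 - S ^ 3 - S ^ 5 - S ^ 6) (-μ))) +
      Module.finrank ℂ (LinearMap.ker (S - 1)) = Module.finrank ℂ V := by
  have hμ' : (-μ) ^ 2 = -7 := by rw [neg_sq, hμ]
  have e1 := (isProj_ker_inf_eigenspace_weilElement hS hT hST hμ).trace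
  have e2 := (isProj_ker_inf_eigenspace_weilElement hS hT hST hμ').trace
  have eL := trace_weilElement_sq_mul_sum_range_pow hS hST
  rw [map_smul, add_mul, map_add, smul_mul_assoc, map_smul, smul_eq_mul, smul_eq_mul] at e1 e2
  have key : (3 : ℂ) * (Module.finrank ℂ ↥(LinearMap.ker (T - 1) ⊓
          Module.End.eigenspace (S + S ^ 2 + S ^ 4 - S ^ 3 - S ^ 5 - S ^ 6) μ) +
        Module.finrank ℂ ↥(LinearMap.ker (T - 1) ⊓
          Module.End.eigenspace (S + S ^ 2 + S ^ 4 - S ^ 3 - S ^ 5 - S ^ 6) (-μ))) +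
      Module.finrank ℂ (LinearMap.ker (S - 1)) = Module.finrank ℂ V := by
    linear_combination (-3 : ℂ) * e1 - 3 * e2 - (7 : ℂ)⁻¹ * eL
  exact_mod_cast key

end LinearAlgebra

/-! ### §2 The curve: Hodge splitting of `X_ν` and the count `6` from the symmetry `υ` -/

section Curve

variable {C : Motives.SchemeOver ℂ}

/-- **Hodge components of an eigenvector of an operator preserving `H^{1,0}` and `H^{0,1}` are
eigenvectors** (same eigenvalue): `(Fa - μa) + (Fb - μb) = 0` with summands of different types.
(`eigenvector_components` of `DegreeOneHodgeTypes` is the case `F = g^*`.) [cite: VoisinHodgeI2002, §7.3.2 and Cor. 6.14] -/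
theorem components_of_forall_map_mem {n : ℕ} {X : Motives.SchemeOver ℂ} (hX : IsSmoothProjective n X)
    (F : Module.End ℂ (complexBetti X 1)) (hF1 : ∀ x ∈ hodgeOneZero hX, F x ∈ hodgeOneZero hX)
    (hF2 : ∀ x ∈ hodgeZeroOne hX, F x ∈ hodgeZeroOne hX) (μ : ℂ) {v a b : complexBetti X 1}
    (hv : F v = μ • v) (hab : a + b = v) (ha : a ∈ hodgeOneZero hX) (hb : b ∈ hodgeZeroOne hX) :
    F a = μ • a ∧ F b = μ • b := by
  have hsum : (F a - μ • a) + (F b - μ • b) = 0 := by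
    have h1 : F a + F b = μ • a + μ • b := by rw [← map_add, ← smul_add, hab, hv]
    calc (F a - μ • a) + (F b - μ • b) = (F a + F b) - (μ • a + μ • b) := by abel
      _ = 0 := by rw [h1, sub_self]
  have h1 : F a - μ • a ∈ hodgeOneZero hX :=
    Submodule.sub_mem _ (hF1 a ha) (Submodule.smul_mem _ μ ha)
  have h2 : F b - μ • b ∈ hodgeZeroOne hX :=
    Submodule.sub_mem _ (hF2 b hb) (Submodule.smul_mem _ μ hb)
  have heq : F a - μ • a = -(F b - μ • b) := eq_neg_of_add_eq_zero_left hsum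
  have h1' : F a - μ • a ∈ hodgeZeroOne hX := by rw [heq]; exact Submodule.neg_mem _ h2
  have hza : F a - μ • a = 0 := eq_zero_of_isOfHodgeType_one_zero_of_zero_one hX h1 h1'
  have hzb : F b - μ • b = 0 := by rw [hza, zero_add] at hsum; exact hsum
  exact ⟨sub_eq_zero.1 hza, sub_eq_zero.1 hzb⟩

/-- Powers of a pull-back preserve `H^{1,0}`. [cite: VoisinHodgeI2002, §7.3.2] -/
theorem pow_map_mem_hodgeOneZero (hC : IsSmoothProjective 1 C) (σ : C ⟶ C) (k : ℕ)
    {x : complexBetti C 1} (hx : x ∈ hodgeOneZero hC) :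
    ((complexBetti.map σ 1).hom ^ k) x ∈ hodgeOneZero hC := by
  induction k generalizing x with
  | zero => exact hx
  | succ k ih => rw [pow_succ, Module.End.mul_apply]; exact ih (map_mem_hodgeOneZero hC σ hx)

/-- Powers of a pull-back preserve `H^{0,1}`. [cite: VoisinHodgeI2002, §7.3.2] -/
theorem pow_map_mem_hodgeZeroOne (hC : IsSmoothProjective 1 C) (σ : C ⟶ C) (k : ℕ)
    {x : complexBetti C 1} (hx : x ∈ hodgeZeroOne hC) :
    ((complexBetti.map σ 1).hom ^ k) x ∈ hodgeZeroOne hC := by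
  induction k generalizing x with
  | zero => exact hx
  | succ k ih => rw [pow_succ, Module.End.mul_apply]; exact ih (map_mem_hodgeZeroOne hC σ hx)

/-- The Gauss-sum element `η_C` of `σ^*` preserves `H^{1,0}`. [cite: VoisinHodgeI2002, §7.3.2] -/
theorem weilElement_map_mem_hodgeOneZero (hC : IsSmoothProjective 1 C) (σ : C ⟶ C)
    {x : complexBetti C 1} (hx : x ∈ hodgeOneZero hC) :
    ((complexBetti.map σ 1).hom + (complexBetti.map σ 1).hom ^ 2 + (complexBetti.map σ 1).hom ^ 4 -
        (complexBetti.map σ 1).hom ^ 3 - (complexBetti.map σ 1).hom ^ 5 -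
        (complexBetti.map σ 1).hom ^ 6) x ∈ hodgeOneZero hC := by
  simp only [LinearMap.add_apply, LinearMap.sub_apply]
  have h := fun k => pow_map_mem_hodgeOneZero hC σ k hx
  exact Submodule.sub_mem _ (Submodule.sub_mem _ (Submodule.sub_mem _ (Submodule.add_mem _
    (Submodule.add_mem _ (map_mem_hodgeOneZero hC σ hx) (h 2)) (h 4)) (h 3)) (h 5)) (h 6)

/-- The Gauss-sum element `η_C` of `σ^*` preserves `H^{0,1}`. [cite: VoisinHodgeI2002, §7.3.2] -/
theorem weilElement_map_mem_hodgeZeroOne (hC : IsSmoothProjective 1 C) (σ : C ⟶ C)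
    {x : complexBetti C 1} (hx : x ∈ hodgeZeroOne hC) :
    ((complexBetti.map σ 1).hom + (complexBetti.map σ 1).hom ^ 2 + (complexBetti.map σ 1).hom ^ 4 -
        (complexBetti.map σ 1).hom ^ 3 - (complexBetti.map σ 1).hom ^ 5 -
        (complexBetti.map σ 1).hom ^ 6) x ∈ hodgeZeroOne hC := by
  simp only [LinearMap.add_apply, LinearMap.sub_apply]
  have h := fun k => pow_map_mem_hodgeZeroOne hC σ k hx
  exact Submodule.sub_mem _ (Submodule.sub_mem _ (Submodule.sub_mem _ (Submodule.add_mem _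
    (Submodule.add_mem _ (map_mem_hodgeZeroOne hC σ hx) (h 2)) (h 4)) (h 3)) (h 5)) (h 6)

/-- **`X_ν = (X_ν ∩ H^{1,0}) ⊕ (X_ν ∩ H^{0,1})`** for `X_ν = H¹(C)^τ ∩ ker(η_C - ν)`: the Hodge
components of an element of `X_ν` lie in `X_ν` (`τ^*` and `η_C` preserve the Hodge types).
[cite: vanGeemen1994HodgeAV, 4.9 and proof of Lemma 5.2] [cite: VoisinHodgeI2002, Cor. 6.14] -/
theorem ker_inf_eigenspace_eq_sup (hC : IsSmoothProjective 1 C) (σ τ : C ⟶ C) (ν : ℂ) :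
    LinearMap.ker ((complexBetti.map τ 1).hom - 1) ⊓
      Module.End.eigenspace ((complexBetti.map σ 1).hom + (complexBetti.map σ 1).hom ^ 2 +
          (complexBetti.map σ 1).hom ^ 4 - (complexBetti.map σ 1).hom ^ 3 -
          (complexBetti.map σ 1).hom ^ 5 - (complexBetti.map σ 1).hom ^ 6) ν =
    (LinearMap.ker ((complexBetti.map τ 1).hom - 1) ⊓
      Module.End.eigenspace ((complexBetti.map σ 1).hom + (complexBetti.map σ 1).hom ^ 2 +
          (complexBetti.map σ 1).hom ^ 4 - (complexBetti.map σ 1).hom ^ 3 -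
          (complexBetti.map σ 1).hom ^ 5 - (complexBetti.map σ 1).hom ^ 6) ν ⊓ hodgeOneZero hC) ⊔
    (LinearMap.ker ((complexBetti.map τ 1).hom - 1) ⊓
      Module.End.eigenspace ((complexBetti.map σ 1).hom + (complexBetti.map σ 1).hom ^ 2 +
          (complexBetti.map σ 1).hom ^ 4 - (complexBetti.map σ 1).hom ^ 3 -
          (complexBetti.map σ 1).hom ^ 5 - (complexBetti.map σ 1).hom ^ 6) ν ⊓ hodgeZeroOne hC) := by
  set T := (complexBetti.map τ 1).hom with hT
  set η := (complexBetti.map σ 1).hom + (complexBetti.map σ 1).hom ^ 2 +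
    (complexBetti.map σ 1).hom ^ 4 - (complexBetti.map σ 1).hom ^ 3 -
    (complexBetti.map σ 1).hom ^ 5 - (complexBetti.map σ 1).hom ^ 6 with hη
  refine le_antisymm (fun v hv ↦ ?_) (sup_le inf_le_left inf_le_left)
  rw [Submodule.mem_inf, LinearMap.mem_ker, LinearMap.sub_apply, Module.End.one_apply, sub_eq_zero,
    Module.End.mem_eigenspace_iff] at hv
  obtain ⟨hvT, hvη⟩ := hv
  obtain ⟨a, b, hab, ha, hb⟩ := exists_add_eq_of_isOfHodgeType_one hC v
  have hvT' : T v = (1 : ℂ) • v := by rw [one_smul]; exact hvT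
  obtain ⟨haT, hbT⟩ := components_of_forall_map_mem hC T (fun x hx => map_mem_hodgeOneZero hC τ hx)
    (fun x hx => map_mem_hodgeZeroOne hC τ hx) 1 hvT' hab ha hb
  obtain ⟨haη, hbη⟩ := components_of_forall_map_mem hC η
    (fun x hx => weilElement_map_mem_hodgeOneZero hC σ hx)
    (fun x hx => weilElement_map_mem_hodgeZeroOne hC σ hx) ν hvη hab ha hb
  rw [one_smul] at haT hbT
  rw [← hab]
  refine Submodule.add_mem_sup ⟨Submodule.mem_inf.2 ⟨?_, Module.End.mem_eigenspace_iff.2 haη⟩, ha⟩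
    ⟨Submodule.mem_inf.2 ⟨?_, Module.End.mem_eigenspace_iff.2 hbη⟩, hb⟩
  · rw [LinearMap.mem_ker, LinearMap.sub_apply, Module.End.one_apply, sub_eq_zero]; exact haT
  · rw [LinearMap.mem_ker, LinearMap.sub_apply, Module.End.one_apply, sub_eq_zero]; exact hbT

/-- **`dim X_ν = dim (X_ν ∩ H^{1,0}) + dim (X_ν ∩ H^{0,1})`**, `X_ν = H¹(C)^τ ∩ ker(η_C - ν)`.
[cite: vanGeemen1994HodgeAV, 4.9] -/
theorem finrank_ker_inf_eigenspace_eq_add (hC : IsSmoothProjective 1 C) (σ τ : C ⟶ C) (ν : ℂ) :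
    Module.finrank ℂ ↥(LinearMap.ker ((complexBetti.map τ 1).hom - 1) ⊓
      Module.End.eigenspace ((complexBetti.map σ 1).hom + (complexBetti.map σ 1).hom ^ 2 +
          (complexBetti.map σ 1).hom ^ 4 - (complexBetti.map σ 1).hom ^ 3 -
          (complexBetti.map σ 1).hom ^ 5 - (complexBetti.map σ 1).hom ^ 6) ν) =
    Module.finrank ℂ ↥(LinearMap.ker ((complexBetti.map τ 1).hom - 1) ⊓
      Module.End.eigenspace ((complexBetti.map σ 1).hom + (complexBetti.map σ 1).hom ^ 2 +
          (complexBetti.map σ 1).hom ^ 4 - (complexBetti.map σ 1).hom ^ 3 -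
          (complexBetti.map σ 1).hom ^ 5 - (complexBetti.map σ 1).hom ^ 6) ν ⊓ hodgeOneZero hC) +
    Module.finrank ℂ ↥(LinearMap.ker ((complexBetti.map τ 1).hom - 1) ⊓
      Module.End.eigenspace ((complexBetti.map σ 1).hom + (complexBetti.map σ 1).hom ^ 2 +
          (complexBetti.map σ 1).hom ^ 4 - (complexBetti.map σ 1).hom ^ 3 -
          (complexBetti.map σ 1).hom ^ 5 - (complexBetti.map σ 1).hom ^ 6) ν ⊓ hodgeZeroOne hC) := by
  haveI := finite_complexBetti_of_isSmoothProjective hC 1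
  set X := LinearMap.ker ((complexBetti.map τ 1).hom - 1) ⊓
      Module.End.eigenspace ((complexBetti.map σ 1).hom + (complexBetti.map σ 1).hom ^ 2 +
          (complexBetti.map σ 1).hom ^ 4 - (complexBetti.map σ 1).hom ^ 3 -
          (complexBetti.map σ 1).hom ^ 5 - (complexBetti.map σ 1).hom ^ 6) ν with hX
  have h := Submodule.finrank_sup_add_finrank_inf_eq (X ⊓ hodgeOneZero hC) (X ⊓ hodgeZeroOne hC)
  have hinf : X ⊓ hodgeOneZero hC ⊓ (X ⊓ hodgeZeroOne hC) = ⊥ := by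
    rw [eq_bot_iff]
    rintro x ⟨⟨-, h1⟩, -, h2⟩
    rw [Submodule.mem_bot]
    exact eq_zero_of_isOfHodgeType_one_zero_of_zero_one hC h1 h2
  rw [← ker_inf_eigenspace_eq_sup hC σ τ ν, hinf, finrank_bot, add_zero] at h
  exact h

/-- **The holomorphic count from the symmetric free action.** Let a group `G` act on the smooth
projective complex curve `C` (`ρ : G →* Aut C`) and let `s, t, u ∈ G` with `s⁷ = 1`, `t³ = 1`,
`t s = s² t`, `u s = s³ u`, `t = u²` (an `F₄₂ = ℤ/7 ⋊ (ℤ/7)ˣ` through which `ρ` factors), with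
`ρ(s)` fixed-point free on `C(ℂ)` and `b₁(C(ℂ)) = 86`. Then for `σ = ρ(s)`, `τ = ρ(t)` and
`η_C = σ^* + (σ^*)² + (σ^*)⁴ - (σ^*)³ - (σ^*)⁵ - (σ^*)⁶`:
**`dim (H¹(C)^τ ∩ ker(η_C - i√7) ∩ H^{1,0}(C)) = 6`.** Proof: with `X_± = H¹(C)^τ ∩ ker(η_C ∓ i√7)`
and `c_± = dim (X_± ∩ H^{1,0})`, `d_± = dim (X_± ∩ H^{0,1})`: `dim X₊ + dim X₋ = 24` (§1,
`three_mul_finrank_ker_inf_eigenspace_add` with `dim H¹(C)^σ = 14` by Smith theory,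
`seven_mul_finrank_ker_sub_one_eq`), `dim X_± = c_± + d_±` (`finrank_ker_inf_eigenspace_eq_add`),
`d_± = c_∓` (conjugation, `finrank_inf_hodgeOneZero_eq_finrank_inf_hodgeZeroOne`), and `c₊ = c₋`
(the symmetry `υ = ρ(u)`: `υ^*` preserves `H^{1,0}`, `σ^* υ^* = υ^* (σ^*)³`, `τ^* = (υ^*)²`;
`finrank_ker_inf_eigenspace_inf_eq_of_symmetry`). Hence `4 c₊ = 24`. This is hypothesis `h6` of
`exists_heckePrymDatum_F21_of_isIso_of_nonempty_jacobian_of_curve`, obtained here WITHOUT the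
holomorphic Lefschetz formula or the holomorphic Chevalley–Weil theorem.
[cite: LangeRodriguez2022, §3.2 (3.6) (PDF p. 56) and §3.5 Cor. 3.5.9–3.5.10 (PDF pp. 70–71)]
[cite: VoisinHodgeI2002, §6.1.3 Cor. 6.12, Cor. 6.14 and §7.3.2] -/
theorem finrank_inf_hodgeOneZero_eq_six_of_symmetry (hC : IsSmoothProjective 1 C) {G : Type*}
    [Group G] (ρ : G →* Aut C) (s t u : G) (hs : s ^ 7 = 1) (ht : t ^ 3 = 1)
    (hts : t * s = s ^ 2 * t) (hus : u * s = s ^ 3 * u) (htu : t = u ^ 2)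
    (hfree : ∀ P : ComplexPoints C, P ≫ (ρ s).hom ≠ P)
    (h86 : Module.finrank ℂ (complexBetti C 1) = 86) :
    Module.finrank ℂ ↥(LinearMap.ker ((complexBetti.map (ρ t).hom 1).hom - 1) ⊓
      Module.End.eigenspace ((complexBetti.map (ρ s).hom 1).hom + (complexBetti.map (ρ s).hom 1).hom ^ 2 +
          (complexBetti.map (ρ s).hom 1).hom ^ 4 - (complexBetti.map (ρ s).hom 1).hom ^ 3 -
          (complexBetti.map (ρ s).hom 1).hom ^ 5 - (complexBetti.map (ρ s).hom 1).hom ^ 6)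
        (Complex.I * (Real.sqrt (7 : ℝ) : ℂ)) ⊓ hodgeOneZero hC) = 6 := by
  haveI := finite_complexBetti_of_isSmoothProjective hC 1
  -- the pull-back representation of `G` on `W = H¹(C(ℂ); ℂ)` (an anti-homomorphism)
  let R : G → Module.End ℂ (complexBetti C 1) := fun g => (complexBetti.map (ρ g).hom 1).hom
  have hR : ∀ g, R g = (complexBetti.map (ρ g).hom 1).hom := fun g => rfl
  have R1 : R 1 = 1 := by
    refine LinearMap.ext fun y => ?_
    rw [hR, map_one, Module.End.one_apply]
    change (complexBetti.map (𝟙 C) 1).hom y = y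
    rw [complexBetti.map_id]
    rfl
  have Rmul : ∀ g h : G, R (g * h) = R h * R g := by
    intro g h
    refine LinearMap.ext fun y => ?_
    rw [hR, Module.End.mul_apply, hR, hR, map_mul, Aut.Aut_mul_def, Iso.trans_hom,
      complexBetti_map_comp_hom', LinearMap.comp_apply]
  have Rpow : ∀ (g : G) (n : ℕ), R (g ^ n) = R g ^ n := by
    intro g n
    induction n with
    | zero => rw [pow_zero, pow_zero, R1]
    | succ n ih => rw [pow_succ, Rmul, ih, ← pow_succ']
  -- the relations among `S = σ^*`, `T = τ^*`, `U = υ^*`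
  have hS7 : (complexBetti.map (ρ s).hom 1).hom ^ 7 = 1 := by rw [← hR, ← Rpow, hs, R1]
  have hT3 : (complexBetti.map (ρ t).hom 1).hom ^ 3 = 1 := by rw [← hR, ← Rpow, ht, R1]
  have hST : (complexBetti.map (ρ s).hom 1).hom * (complexBetti.map (ρ t).hom 1).hom =
      (complexBetti.map (ρ t).hom 1).hom * (complexBetti.map (ρ s).hom 1).hom ^ 2 := by
    rw [← hR, ← hR, ← Rmul, hts, Rmul, Rpow]
  have hSU : (complexBetti.map (ρ s).hom 1).hom * (complexBetti.map (ρ u).hom 1).hom =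
      (complexBetti.map (ρ u).hom 1).hom * (complexBetti.map (ρ s).hom 1).hom ^ 3 := by
    rw [← hR, ← hR, ← Rmul, hus, Rmul, Rpow]
  have hTU : (complexBetti.map (ρ t).hom 1).hom = (complexBetti.map (ρ u).hom 1).hom ^ 2 := by
    rw [← hR, ← hR, htu, Rpow]
  -- `μ = i√7`: `μ² = -7`, `conj μ = -μ`
  have hμ : (Complex.I * (Real.sqrt (7 : ℝ) : ℂ)) ^ 2 = -7 := by
    rw [mul_pow, Complex.I_sq, ← Complex.ofReal_pow, Real.sq_sqrt (by norm_num : (0:ℝ) ≤ 7), neg_one_mul]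
    norm_num
  have hconj : starRingEnd ℂ (Complex.I * (Real.sqrt (7 : ℝ) : ℂ)) = -(Complex.I * (Real.sqrt (7 : ℝ) : ℂ)) := by
    rw [map_mul, Complex.conj_I, Complex.conj_ofReal, neg_mul]
  have hconj' : starRingEnd ℂ (-(Complex.I * (Real.sqrt (7 : ℝ) : ℂ))) = Complex.I * (Real.sqrt (7 : ℝ) : ℂ) := by
    rw [map_neg, hconj, neg_neg]
  -- Smith theory: `dim H¹(C)^σ = 14`
  have hσ7 : (ρ s).hom ≫ (ρ s).hom ≫ (ρ s).hom ≫ (ρ s).hom ≫ (ρ s).hom ≫ (ρ s).hom ≫ (ρ s).hom = 𝟙 C := by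
    rw [← aut_pow_seven_hom, ← map_pow, hs, map_one]
    rfl
  have h14 := seven_mul_finrank_ker_sub_one_eq hC (ρ s).hom hσ7 hfree
  rw [h86] at h14
  -- the topological count `dim X₊ + dim X₋ = 24`
  have hA := three_mul_finrank_ker_inf_eigenspace_add hS7 hT3 hST hμ
  rw [h86] at hA
  -- Hodge splitting and conjugation
  have hC1 := finrank_ker_inf_eigenspace_eq_add hC (ρ s).hom (ρ t).hom (Complex.I * (Real.sqrt (7 : ℝ) : ℂ))
  have hC2 := finrank_ker_inf_eigenspace_eq_add hC (ρ s).hom (ρ t).hom (-(Complex.I * (Real.sqrt (7 : ℝ) : ℂ)))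
  have hD1 := finrank_inf_hodgeOneZero_eq_finrank_inf_hodgeZeroOne hC (ρ s).hom (ρ t).hom
    (Complex.I * (Real.sqrt (7 : ℝ) : ℂ))
  rw [hconj] at hD1
  have hD2 := finrank_inf_hodgeOneZero_eq_finrank_inf_hodgeZeroOne hC (ρ s).hom (ρ t).hom
    (-(Complex.I * (Real.sqrt (7 : ℝ) : ℂ)))
  rw [hconj'] at hD2
  -- the symmetry `υ^*`: `c₊ = c₋`
  have hB := finrank_ker_inf_eigenspace_inf_eq_of_symmetry hS7 hT3 hSU hTU (hodgeOneZero hC)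
    (fun x hx => map_mem_hodgeOneZero hC (ρ u).hom hx) (Complex.I * (Real.sqrt (7 : ℝ) : ℂ))
  omega

end Curve

/-! ### §3 The Frobenius group `F₄₂ = ℤ/7 ⋊ (ℤ/7)ˣ` and the étale `F₄₂`-curve of genus `43` -/

section RiemannExistence

/-- **The Frobenius group `F₄₂ = ℤ/7 ⋊ (ℤ/7)ˣ`** (the holomorph of `ℤ/7`) as a Mathlib semidirect
product `Multiplicative (ℤ/7) ⋊ ⟨3⟩`, `⟨3⟩ = (ℤ/7)ˣ` acting by multiplication: it has order `42`,
elements `s` (order `7`) and `u` (order `6`) with `u s = s³ u`, `u² s = s² u²` (so `s, t = u²`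
satisfy the `F₂₁`-relations), `s ≠ 1`, `u² ≠ 1`, and `s, u` generate — so `(s, u; 1, 1)` is a
generating vector of `F₄₂` of type `(2; —)` in the sense of [LangeRodriguez2022, §3.1.2].
[cite: LangeRodriguez2022, §3.1.2 (PDF p. 51)] -/
theorem exists_group_F42 :
    ∃ (G : Type) (_ : Group G) (_ : Finite G) (s u : G), Nat.card G = 42 ∧ s ^ 7 = 1 ∧ u ^ 6 = 1 ∧
      u * s = s ^ 3 * u ∧ u ^ 2 * s = s ^ 2 * u ^ 2 ∧ s ≠ 1 ∧ u ^ 2 ≠ 1 ∧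
      Subgroup.closure ({s, u} : Set G) = ⊤ := by
  -- `N = ℤ/7` (written multiplicatively), `(ℤ/7)ˣ` acting by multiplication, `K = ⟨3⟩ = (ℤ/7)ˣ`
  let N := Multiplicative (ZMod 7)
  let φ : (ZMod 7)ˣ →* MulAut N :=
    (MulAutMultiplicative (ZMod 7)).symm.toMonoidHom.comp AddAut.mulLeft
  have hφ : ∀ (w : (ZMod 7)ˣ) (a : ZMod 7),
      φ w (Multiplicative.ofAdd a) = Multiplicative.ofAdd ((w : ZMod 7) * a) := fun w a => rfl
  let u3 : (ZMod 7)ˣ := ZMod.unitOfCoprime 3 (by decide)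
  have hu3 : (u3 : ZMod 7) = 3 := rfl
  have hu3_6 : u3 ^ 6 = 1 := Units.ext (by rw [Units.val_pow_eq_pow_val, hu3]; decide)
  have hord : orderOf u3 = 6 := by
    refine (orderOf_eq_iff (by norm_num)).2 ⟨hu3_6, fun m hm hm0 h => ?_⟩
    have hv := congrArg (fun w : (ZMod 7)ˣ => (w : ZMod 7)) h
    simp only [Units.val_pow_eq_pow_val, hu3, Units.val_one] at hv
    interval_cases m <;> exact absurd hv (by decide)
  let K : Subgroup (ZMod 7)ˣ := Subgroup.zpowers u3
  let G := N ⋊[φ.comp K.subtype] K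
  let s : G := SemidirectProduct.inl (Multiplicative.ofAdd (1 : ZMod 7))
  let u₀ : K := ⟨u3, Subgroup.mem_zpowers u3⟩
  let u : G := SemidirectProduct.inr u₀
  have hKcard : Nat.card K = 6 := by rw [Nat.card_zpowers, hord]
  have hNcard : Nat.card N = 7 := by
    rw [Nat.card_congr Multiplicative.toAdd, Nat.card_zmod]
  haveI : Finite G := by
    haveI : Finite N := Nat.finite_of_card_ne_zero (by rw [hNcard]; norm_num)
    haveI : Finite K := Nat.finite_of_card_ne_zero (by rw [hKcard]; norm_num)
    exact Finite.of_equiv _ SemidirectProduct.equivProd.symm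
  -- conjugation by `w ∈ K`: `w s = s^c w` for `w = c` in `ℤ/7`
  have hconj : ∀ (w : K) (c : ℕ), ((w : (ZMod 7)ˣ) : ZMod 7) = c →
      SemidirectProduct.inr w * s = s ^ c * SemidirectProduct.inr w := by
    intro w c hc
    have key := SemidirectProduct.inl_aut (φ := φ.comp K.subtype) w (Multiplicative.ofAdd (1 : ZMod 7))
    have e : (φ.comp K.subtype) w (Multiplicative.ofAdd (1 : ZMod 7)) =
        Multiplicative.ofAdd (1 : ZMod 7) ^ c := by
      rw [MonoidHom.comp_apply, Subgroup.subtype_apply, hφ, hc, mul_one, ← ofAdd_nsmul, nsmul_one]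
    rw [e, map_pow, map_inv] at key
    change s ^ c = SemidirectProduct.inr w * s * (SemidirectProduct.inr w)⁻¹ at key
    rw [key, inv_mul_cancel_right]
  have hu₀2 : (((u₀ ^ 2 : K) : (ZMod 7)ˣ) : ZMod 7) = (2 : ℕ) := by
    rw [SubmonoidClass.coe_pow, Units.val_pow_eq_pow_val]
    change (3 : ZMod 7) ^ 2 = (2 : ℕ)
    decide
  refine ⟨G, inferInstance, inferInstance, s, u, ?_, ?_, ?_, ?_, ?_, ?_, ?_, ?_⟩
  · rw [SemidirectProduct.card, hNcard, hKcard]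
  · -- `s⁷ = 1`
    rw [← map_pow, ← ofAdd_nsmul, nsmul_one]
    change SemidirectProduct.inl (Multiplicative.ofAdd ((7 : ℕ) : ZMod 7)) = 1
    rw [show ((7 : ℕ) : ZMod 7) = 0 by decide, ofAdd_zero, map_one]
  · -- `u⁶ = 1`
    rw [← map_pow]
    have : u₀ ^ 6 = 1 := Subtype.ext (by rw [SubmonoidClass.coe_pow]; exact hu3_6)
    rw [this, map_one]
  · -- `u s = s³ u`
    exact hconj u₀ 3 rfl
  · -- `u² s = s² u²`
    rw [← map_pow]
    exact hconj (u₀ ^ 2) 2 hu₀2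
  · -- `s ≠ 1`
    intro h
    have h' : Multiplicative.ofAdd (1 : ZMod 7) = Multiplicative.ofAdd 0 :=
      (SemidirectProduct.inl_injective (h.trans (map_one _).symm)).trans ofAdd_zero.symm
    exact absurd (Multiplicative.ofAdd.injective h') (by decide)
  · -- `u² ≠ 1`
    intro h
    rw [← map_pow] at h
    have h' : u₀ ^ 2 = 1 := SemidirectProduct.inr_injective (h.trans (map_one _).symm)
    have hv : (((u₀ ^ 2 : K) : (ZMod 7)ˣ) : ZMod 7) = (((1 : K) : (ZMod 7)ˣ) : ZMod 7) := by rw [h']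
    rw [hu₀2, OneMemClass.coe_one, Units.val_one] at hv
    exact absurd hv (by decide)
  · -- generation
    rw [eq_top_iff]
    rintro x -
    rw [← SemidirectProduct.inl_left_mul_inr_right x]
    refine Subgroup.mul_mem _ ?_ ?_
    · have ha : ∀ a : ZMod 7, Multiplicative.ofAdd a = Multiplicative.ofAdd (1 : ZMod 7) ^ a.val := by
        intro a
        rw [← ofAdd_nsmul, nsmul_one, ZMod.natCast_zmod_val]
      have hx : SemidirectProduct.inl x.left = s ^ (Multiplicative.toAdd x.left).val := by
        rw [← map_pow, ← ha, ofAdd_toAdd]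
      rw [hx]
      exact Subgroup.pow_mem _ (Subgroup.subset_closure (Set.mem_insert _ _)) _
    · obtain ⟨z, hz⟩ := Subgroup.mem_zpowers_iff.1 x.right.2
      have hx : SemidirectProduct.inr x.right = u ^ z := by
        rw [← map_zpow]
        congr 1
        exact Subtype.ext (by rw [SubgroupClass.coe_zpow]; exact hz.symm)
      rw [hx]
      exact Subgroup.zpow_mem _ (Subgroup.subset_closure (Set.mem_insert_of_mem s (Set.mem_singleton u))) _

/-- **The étale `F₄₂`-curve of genus `43` from Riemann's existence theorem.** Granted Riemann's
existence theorem for Galois covers with prescribed group in the unramified case — hypothesis `hRE`,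
VERBATIM as in `exists_curve_F21_of_riemannExistence` ([LangeRodriguez2022, Thm. 3.1.1 (⇐) with
(3.2)] at `s = 0` branch points, on the tree's carriers) — the generating vector `(s, u; 1, 1)` of
`F₄₂` of type `(2; —)` (`exists_group_F42`) yields a smooth projective complex curve of genus
`1 + 42·1 = 43` with a free `F₄₂`-action; `s`, `t = u²` satisfy the `F₂₁`-relations and `u s = s³ u`.
[cite: LangeRodriguez2022, §3.1.2 Thm. 3.1.1 and (3.2) (PDF p. 52)] [cite: SGA1, Exp. XII Thm. 5.1] -/
theorem exists_curve_F42_of_riemannExistence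
    (hRE : ∀ (G : Type) [Group G] [Finite G] (g' : ℕ) (a b : Fin g' → G), 2 ≤ g' →
      Subgroup.closure (Set.range a ∪ Set.range b) = ⊤ →
      (List.ofFn fun i => a i * b i * (a i)⁻¹ * (b i)⁻¹).prod = 1 →
      ∃ (C : Motives.SchemeOver ℂ) (_ : IsSmoothProjective 1 C) (ρ : G →* Aut C),
        (∀ g : G, g ≠ 1 → ∀ P : ComplexPoints C, P ≫ (ρ g).hom ≠ P) ∧
        Literature.NumberTheory.DiophantineGeometry.genus C = 1 + Nat.card G * (g' - 1)) :
    ∃ (C : Motives.SchemeOver ℂ) (_ : IsSmoothProjective 1 C) (G : Type) (_ : Group G)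
      (ρ : G →* Aut C) (s t u : G), s ^ 7 = 1 ∧ t ^ 3 = 1 ∧ t * s = s ^ 2 * t ∧
      u * s = s ^ 3 * u ∧ t = u ^ 2 ∧ s ≠ 1 ∧ t ≠ 1 ∧
      (∀ g : G, g ≠ 1 → ∀ P : ComplexPoints C, P ≫ (ρ g).hom ≠ P) ∧
      Literature.NumberTheory.DiophantineGeometry.genus C = 43 := by
  obtain ⟨G, _, _, s, u, hcard, hs, hu, hus, hts, hs1, ht1, hgen⟩ := exists_group_F42
  -- the generating vector `(s, u; 1, 1)` of type `(2; —)`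
  have hclosure : Subgroup.closure (Set.range ![s, u] ∪ Set.range (fun _ : Fin 2 => (1 : G))) = ⊤ := by
    rw [eq_top_iff, ← hgen]
    refine Subgroup.closure_mono (Set.insert_subset_iff.2 ⟨Set.mem_union_left _ ⟨0, rfl⟩,
      Set.singleton_subset_iff.2 (Set.mem_union_left _ ⟨1, rfl⟩)⟩)
  have hprod : (List.ofFn fun i : Fin 2 =>
      ![s, u] i * (fun _ : Fin 2 => (1 : G)) i * (![s, u] i)⁻¹ * ((fun _ : Fin 2 => (1 : G)) i)⁻¹).prod = 1 := by
    simp only [mul_one, inv_one, mul_inv_cancel, List.ofFn_const, List.prod_replicate, one_pow]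
  obtain ⟨C, hC, ρ, hfree, hg⟩ := hRE G 2 ![s, u] (fun _ => 1) le_rfl hclosure hprod
  refine ⟨C, hC, G, inferInstance, ρ, s, u ^ 2, u, hs, ?_, hts, hus, rfl, hs1, ht1, hfree, ?_⟩
  · rw [← pow_mul, hu]
  · rw [hg, hcard]

end RiemannExistence

/-! ### §4 Assembly: the named fact from Riemann existence and the two Jacobian facts -/

section Assembly

/-- **The curve-level datum from Riemann's existence theorem alone.** Granted `hRE` (Riemann's
existence theorem for free actions with prescribed group, [LangeRodriguez2022, Thm. 3.1.1 (⇐),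
`s = 0`]; verbatim the hypothesis of `exists_heckePrymDatum_F21_of_riemannExistence_of_holomorphicLefschetz`),
there is a smooth projective complex curve `C` with `b₁(C(ℂ)) = 86` and fixed-point-free
automorphisms `σ⁷ = 𝟙`, `τ³ = 𝟙`, `σ ≫ τ = τ ≫ σ ≫ σ` such that
`dim (H¹(C)^τ ∩ ker(η_C - i√7) ∩ H^{1,0}(C)) = 6` — exactly the hypothesis `h` of
`exists_heckePrymDatum_F21_of_isIso_of_nonempty_jacobian_of_curve` (`…WeilTypeOfCurve`): the étale
`F₄₂`-curve of §3 with `σ = ρ(s)`, `τ = ρ(u²)`, the count being §2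
(`finrank_inf_hodgeOneZero_eq_six_of_symmetry`, topology plus the symmetry `ρ(u)^*`). No
holomorphic fixed-point theory and no Jacobian enter.
[cite: LangeRodriguez2022, §3.1.2 Thm. 3.1.1 (PDF p. 51), §3.2 (3.6) (PDF p. 56)] -/
theorem exists_curveDatum_F42_of_riemannExistence
    (hRE : ∀ (G : Type) [Group G] [Finite G] (g' : ℕ) (a b : Fin g' → G), 2 ≤ g' →
      Subgroup.closure (Set.range a ∪ Set.range b) = ⊤ →
      (List.ofFn fun i => a i * b i * (a i)⁻¹ * (b i)⁻¹).prod = 1 →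
      ∃ (C : Motives.SchemeOver ℂ) (_ : IsSmoothProjective 1 C) (ρ : G →* Aut C),
        (∀ g : G, g ≠ 1 → ∀ P : ComplexPoints C, P ≫ (ρ g).hom ≠ P) ∧
        Literature.NumberTheory.DiophantineGeometry.genus C = 1 + Nat.card G * (g' - 1)) :
    ∃ (C : Motives.SchemeOver ℂ) (hC : IsSmoothProjective 1 C) (σ τ : C ⟶ C),
      Module.finrank ℂ (complexBetti C 1) = 86 ∧
      σ ≫ σ ≫ σ ≫ σ ≫ σ ≫ σ ≫ σ = 𝟙 C ∧ τ ≫ τ ≫ τ = 𝟙 C ∧ σ ≫ τ = τ ≫ σ ≫ σ ∧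
      (∀ P : ComplexPoints C, P ≫ σ ≠ P ∧ P ≫ τ ≠ P) ∧
      Module.finrank ℂ ↥(LinearMap.ker ((complexBetti.map τ 1).hom - 1) ⊓
        Module.End.eigenspace ((complexBetti.map σ 1).hom + (complexBetti.map σ 1).hom ^ 2 +
            (complexBetti.map σ 1).hom ^ 4 - (complexBetti.map σ 1).hom ^ 3 -
            (complexBetti.map σ 1).hom ^ 5 - (complexBetti.map σ 1).hom ^ 6)
          (Complex.I * (Real.sqrt (7 : ℝ) : ℂ)) ⊓ hodgeOneZero hC) = 6 := by
  obtain ⟨C, hC, G, _, ρ, s, t, u, hs, ht, hts, hus, htu, hs1, ht1, hfree, hg⟩ :=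
    exists_curve_F42_of_riemannExistence hRE
  haveI := finite_complexBetti_of_isSmoothProjective hC 1
  -- genus bookkeeping: `h^{1,0} = 43`, `b₁ = 86`
  have h10 : Module.finrank ℂ (hodgeOneZero hC) = 43 := by rw [finrank_hodgeOneZero_eq_genus hC, hg]
  have h86 : Module.finrank ℂ (complexBetti C 1) = 86 := by
    rw [finrank_complexBetti_one_eq_two_mul_finrank_hodgeOneZero hC, h10]
  -- the holomorphic count, from topology and the symmetry `ρ(u)`
  have h6 := finrank_inf_hodgeOneZero_eq_six_of_symmetry hC ρ s t u hs ht hts hus htu (hfree s hs1) h86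
  -- the relations as morphisms
  have hσ7 : (ρ s).hom ≫ (ρ s).hom ≫ (ρ s).hom ≫ (ρ s).hom ≫ (ρ s).hom ≫ (ρ s).hom ≫ (ρ s).hom = 𝟙 C := by
    rw [← aut_pow_seven_hom, ← map_pow, hs, map_one]
    rfl
  have hτ3 : (ρ t).hom ≫ (ρ t).hom ≫ (ρ t).hom = 𝟙 C := by
    rw [← aut_pow_three_hom, ← map_pow, ht, map_one]
    rfl
  have hστ : (ρ s).hom ≫ (ρ t).hom = (ρ t).hom ≫ (ρ s).hom ≫ (ρ s).hom := by
    have e := congrArg (fun g => (ρ g).hom) hts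
    simp only [map_mul, Aut.Aut_mul_def, Iso.trans_hom, pow_succ, pow_zero, one_mul] at e
    exact e
  have hfree' : ∀ P : ComplexPoints C, P ≫ (ρ s).hom ≠ P ∧ P ≫ (ρ t).hom ≠ P :=
    fun P => ⟨hfree s hs1 P, hfree t ht1 P⟩
  exact ⟨C, hC, (ρ s).hom, (ρ t).hom, h86, hσ7, hτ3, hστ, hfree', h6⟩

/-- **`exists_heckePrymDatum_F21` from Riemann's existence theorem and the two Jacobian facts —
WITHOUT holomorphic fixed-point theory.** Hypotheses: `hRE` — Riemann's existence theorem for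
free actions with prescribed group ([LangeRodriguez2022, Thm. 3.1.1 (⇐), `s = 0`]; verbatim the
hypothesis of `exists_heckePrymDatum_F21_of_riemannExistence_of_holomorphicLefschetz`); `hI`, `hJ` —
the tree's Jacobian facts `Motives.isIso_bettiCohomology_map_abelJacobi`,
`Motives.nonempty_jacobian_of_isSmoothProjective` ([Milne1986JacobianVarieties]). Proof: §3 gives a
smooth projective complex curve of genus `43` (`b₁ = 86`) with a free action of
`F₄₂ = ⟨s, u | s⁷ = u⁶ = 1, u s u⁻¹ = s³⟩`; with `σ = ρ(s)`, `τ = ρ(u²)` (fixed-point free,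
`σ⁷ = τ³ = 𝟙`, `σ ≫ τ = τ ≫ σ ≫ σ`) the holomorphic count
`dim (H¹(C)^τ ∩ ker(η_C - i√7) ∩ H^{1,0}(C)) = 6` is §2
(`finrank_inf_hodgeOneZero_eq_six_of_symmetry`: topology plus the symmetry `ρ(u)^*`, which
anticommutes with `η_C`) — together `exists_curveDatum_F42_of_riemannExistence` — and
`exists_heckePrymDatum_F21_of_isIso_of_nonempty_jacobian_of_curve` (`…WeilTypeOfCurve`) concludes.
Compared with `…OfRiemannExistence` the holomorphic Lefschetz formula `hL` / the Chevalley–Weil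
trace `hCW` is no longer an input.
[cite: LangeRodriguez2022, §3.1.2 Thm. 3.1.1 (PDF p. 51), §3.2 (3.5)–(3.6) (PDF p. 56) and §3.5 Cor. 3.5.9–3.5.10 (PDF pp. 70–71)]
[cite: Milne1986JacobianVarieties, Thm. 1.1, Prop. 2.1 and §6 Prop. 6.4]
[cite: SGA1, Exp. XII Thm. 5.1] -/
theorem exists_heckePrymDatum_F21_of_riemannExistence
    (hRE : ∀ (G : Type) [Group G] [Finite G] (g' : ℕ) (a b : Fin g' → G), 2 ≤ g' →
      Subgroup.closure (Set.range a ∪ Set.range b) = ⊤ →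
      (List.ofFn fun i => a i * b i * (a i)⁻¹ * (b i)⁻¹).prod = 1 →
      ∃ (C : Motives.SchemeOver ℂ) (_ : IsSmoothProjective 1 C) (ρ : G →* Aut C),
        (∀ g : G, g ≠ 1 → ∀ P : ComplexPoints C, P ≫ (ρ g).hom ≠ P) ∧
        Literature.NumberTheory.DiophantineGeometry.genus C = 1 + Nat.card G * (g' - 1))
    (hI : Motives.isIso_bettiCohomology_map_abelJacobi)
    (hJ : Motives.nonempty_jacobian_of_isSmoothProjective.{0}) :
    exists_heckePrymDatum_F21 :=
  exists_heckePrymDatum_F21_of_isIso_of_nonempty_jacobian_of_curve hI hJ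
    (exists_curveDatum_F42_of_riemannExistence hRE)

/-- **`exists_heckePrymDatum_F21` from Riemann's existence theorem and the two LEAF Jacobian facts.**
The same with the Jacobian inputs in their finest existing form: instead of
`isIso_bettiCohomology_map_abelJacobi` its child `Motives.two_mul_dim_eq_finrank_bettiCohomology`
(`2 dim J = b₁(C(ℂ))`, Milne Prop. 2.1 — the two are equivalent theorems-to-be,
`Motives.isIso_bettiCohomology_map_abelJacobi_of_two_mul_dim_eq`, `Motives/JacobianDimensionBounds`),
and instead of `nonempty_jacobian_of_isSmoothProjective` its child
`Motives.nonempty_jacobian_of_algPoints` (a smooth projective curve WITH A RATIONAL POINT has a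
Jacobian, Milne Thm. 1.1 pointed case, `Motives/JacobianExistenceSplit`) — over `ℂ` every smooth
projective curve has a complex point (`Motives.nonempty_algPoints_of_isSmoothProjective`), so no
Galois descent is needed. With `𝒥` such a Jacobian of the `F₄₂`-curve, `dim J = ½ b₁ = 43`, and
`exists_heckePrymDatum_F21_of_isIso_of_curve` (`…WeilTypeOfCurve`) concludes. Hence the named fact
is ONE `exact` away from the three inputs: Riemann's existence theorem `hRE`
[LangeRodriguez2022, Thm. 3.1.1] (not in the tree), `two_mul_dim_eq_finrank_bettiCohomology` and
`nonempty_jacobian_of_algPoints` (named facts of the tree).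
[cite: LangeRodriguez2022, §3.1.2 Thm. 3.1.1 (PDF p. 51) and §3.5 Cor. 3.5.9–3.5.10 (PDF pp. 70–71)]
[cite: Milne1986JacobianVarieties, Thm. 1.1 (pointed case), Prop. 2.1] -/
theorem exists_heckePrymDatum_F21_of_riemannExistence_of_leafFacts
    (hRE : ∀ (G : Type) [Group G] [Finite G] (g' : ℕ) (a b : Fin g' → G), 2 ≤ g' →
      Subgroup.closure (Set.range a ∪ Set.range b) = ⊤ →
      (List.ofFn fun i => a i * b i * (a i)⁻¹ * (b i)⁻¹).prod = 1 →
      ∃ (C : Motives.SchemeOver ℂ) (_ : IsSmoothProjective 1 C) (ρ : G →* Aut C),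
        (∀ g : G, g ≠ 1 → ∀ P : ComplexPoints C, P ≫ (ρ g).hom ≠ P) ∧
        Literature.NumberTheory.DiophantineGeometry.genus C = 1 + Nat.card G * (g' - 1))
    (h2 : Motives.two_mul_dim_eq_finrank_bettiCohomology)
    (hA : Motives.nonempty_jacobian_of_algPoints.{0}) :
    exists_heckePrymDatum_F21 := by
  obtain ⟨C, hC, σ, τ, h86, hσ, hτ, hστ, hfree, h6⟩ := exists_curveDatum_F42_of_riemannExistence hRE
  obtain ⟨P⟩ := Motives.nonempty_algPoints_of_isSmoothProjective hC
  obtain ⟨𝒥⟩ := hA ℂ C hC ⟨P⟩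
  have hdim : 𝒥.J.dim = 43 := by
    have h := h2 C hC 𝒥
    rw [← finrank_complexBetti_eq_finrank_bettiCohomology, h86] at h
    omega
  exact exists_heckePrymDatum_F21_of_isIso_of_curve
    (Motives.isIso_bettiCohomology_map_abelJacobi_of_two_mul_dim_eq h2)
    ⟨C, hC, 𝒥, σ, τ, hdim, hσ, hτ, hστ, hfree, h6⟩

end Assembly

end Literature.AlgebraicGeometry.HodgeTheory

end
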